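import Literature.Analysis.FluidPDE.RenormalizedDiffusivityCascadeProofs
import Literature.Analysis.FluidPDE.RenormalizedDiffusivityCascadeScales
import HarnessLib

/-!
# Armstrong–Vicol, Lemma 3.4 Step 1 on the printed scales for every `β ∈ (1, 4/3)`

Companion to `RenormalizedDiffusivityCascade{,Proofs,Scales}.lean` (S. Armstrong, V. Vicol,
*Anomalous diffusion by fractal homogenization*, Ann. PDE 11 (2025) = arXiv:2305.05048v3, §2.1 (2.8)–(2.10)
p. 19, Lemma 3.4 p. 43 with proof pp. 44–45 [cite: ArmstrongVicol2025]): theorems only, no new facts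
or definitions.

The structure `IsScaleSequence` hard-wires the printed constant `10` of (2.10),
`(1 - 10εₘ) εₘ^q ≤ εₘ₊₁ ≤ (1 + 10εₘ) εₘ^q`, which the printed scales `εₘ⁻¹ = ⌈Λ^{q^m/(q-1)}⌉` satisfy
only for `q < 10`, i.e. `β > 40/39` (`isScaleSequence_scaleSeq`, and the numerics recorded in the
module docstring of `RenormalizedDiffusivityCascadeScales.lean`); for every `q > 1` they satisfy the
same bound with `4q` in place of `10` (`scaleSeq_succ_le_general`). Here:

* `modelDiffusivity_bounds_general` — Lemma 3.4, Step 1 ((3.49)) for sequences satisfying (2.9) and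
  (2.10) with an arbitrary constant `Κ ≥ 0` (plus the smallness `Κ εₘ ≤ 10/128`, `m ≥ 1`, which for
  the printed scales is a largeness condition on the minimal scale separation `Λ`, exactly as the
  paper chooses "`Λ` … to depend only on `β`", p. 19); constants depend on `β, q, Κ`.
* `modelDiffusivity_bounds_of_isScaleSequence` — the case `Κ = 10` recovers the hypotheses of
  `modelDiffusivity_bounds` (sanity check of the generalisation).
* `scaleSeq_superGeometric_max` — the printed scales satisfy (2.10) with `Κ = max(10, 4q)` for
  `m ≥ 1` once `Λ ≥ 2q + 2`.
* `modelDiffusivity_bounds_scaleSeq_all` — Lemma 3.4, Step 1 on the PRINTED scales for EVERY `q > 1`,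
  for all `Λ ≥ 2⁷` with `52 q ≤ Λ`; `modelDiffusivity_bounds_scaleSeq_qExp_all` — the same with
  `q = qExp β` for every `β ∈ (1, 4/3)` (removing the restriction `β > 40/39` of
  `modelDiffusivity_bounds_scaleSeq` / `isScaleSequence_scaleSeq_qExp`).
-/

open Real

namespace Literature.Analysis.FluidPDE

namespace ArmstrongVicol2025

/-- **Armstrong–Vicol, Lemma 3.4, Step 1 ((3.49) p. 44) with the constant of (2.10) as a
parameter.** For `β > 0`, `q > 1` and `Κ ≥ 0` there are constants `0 < c ≤ C` (depending on
`β, q, Κ` only) such that for every positive sequence `ε` with `ε₀ = 1`, minimal scale separation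
`εₘ/εₘ₊₁ ≥ 2⁷` ((2.9)), the super-geometric two-sided bound
`(1 - Κ εₘ) εₘ^q ≤ εₘ₊₁ ≤ (1 + Κ εₘ) εₘ^q` for `m ≥ 1` ((2.10) with `10` replaced by `Κ`) and the
smallness `Κ εₘ ≤ 10/128` for `m ≥ 1`, the model cascade (3.47) started in the window (3.44) obeys
`c aₘ εₘ^{2+γ} ≤ κ'ₘ ≤ C aₘ εₘ^{2+γ}` for `1 ≤ m ≤ M - 1` — the proof of `modelDiffusivity_bounds`
verbatim, the ratio factor (3.52) being `|(εₘ/εₘ₋₁^q)^β - 1| ≤ C εₘ₋₁` with `C = C(β, q, Κ)`.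
Why: the printed "10" of (2.10) holds for the printed scales `εₘ⁻¹ = ⌈Λ^{q^m/(q-1)}⌉` only when
`q < 10` (module docstring of `RenormalizedDiffusivityCascadeScales.lean`: the ceiling's fractional
part forces a constant `≈ q`), whereas `(1 + 4q εₘ) εₘ^q` always holds
(`scaleSeq_succ_le_general`); with `Κ = max(10, 4q)` the lemma therefore applies to the printed
scales for EVERY `q > 1`, i.e. every `β ∈ (1, 4/3)` (`modelDiffusivity_bounds_scaleSeq_all`). The
paper itself allows all constants to depend on `q` (p. 93). [cite: ArmstrongVicol2025, Lemma 3.4 p. 43, proof Step 1 (3.49)–(3.54) p. 44; §2.1 (2.8)–(2.10) p. 19; p. 93] -/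
theorem modelDiffusivity_bounds_general {β q Κ : ℝ} (hβ : 0 < β) (hq : 1 < q) (hΚ : 0 ≤ Κ) :
    ∃ c C : ℝ, 0 < c ∧ c ≤ C ∧
      ∀ ε : ℕ → ℝ, (∀ m, 0 < ε m) → ε 0 = 1 → (∀ m, 2 ^ 7 * ε (m + 1) ≤ ε m) →
        (∀ m, 1 ≤ m →
          (1 - Κ * ε m) * ε m ^ q ≤ ε (m + 1) ∧ ε (m + 1) ≤ (1 + Κ * ε m) * ε m ^ q) →
        (∀ m, 1 ≤ m → Κ * ε m ≤ 10 / 128) →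
        ∀ (M : ℕ) (κ : ℝ),
        ε M ^ (2 * β / (q + 1)) / 2 ≤ κ → κ ≤ 2 * ε M ^ (2 * β / (q + 1)) →
        ∀ m : ℕ, 1 ≤ m → m < M →
          c * (ε m ^ (β - 2) * ε m ^ (2 + gammaExp β q)) ≤
              modelDiffusivity (fun n => ε n ^ (β - 2)) ε M κ m ∧
            modelDiffusivity (fun n => ε n ^ (β - 2)) ε M κ m ≤
              C * (ε m ^ (β - 2) * ε m ^ (2 + gammaExp β q)) := by
  -- the exponents
  set γ := gammaExp β q with hγ
  have hγpos : 0 < γ := gammaExp_pos hβ hq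
  have hγlt : γ < β := gammaExp_lt hβ hq
  set p := β - γ with hp
  have hppos : 0 < p := by rw [hp]; linarith
  have hqp : q * p = β + γ := q_mul_sub_gammaExp hq
  have h2b : 2 * β / (q + 1) = p := two_mul_div_eq_sub_gammaExp hq
  set θ := min 1 (2 * γ) with hθ
  have hθpos : 0 < θ := lt_min one_pos (by linarith)
  have hθ1 : θ ≤ 1 := min_le_left _ _
  have hθ2 : θ ≤ 2 * γ := min_le_right _ _
  -- the normalisation `ν = √(9/80)` of (3.50)
  set ν := Real.sqrt (9 / 80) with hν
  have hνpos : 0 < ν := Real.sqrt_pos.mpr (by norm_num)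
  have hν2 : ν ^ 2 = 9 / 80 := Real.sq_sqrt (by norm_num)
  have hν1 : ν ≤ 1 := by
    rw [hν]; exact (Real.sqrt_le_sqrt (by norm_num)).trans_eq Real.sqrt_one
  -- the constants
  set K := 11 * p * Κ / 10 + 1 with hK
  have hK0 : 0 ≤ K := by rw [hK]; positivity
  set ρ := (((2 : ℝ) ^ 7)⁻¹) ^ θ with hρ
  have hρ1 : ρ < 1 := rpow_lt_one (by positivity) (by norm_num) hθpos
  have hK'0 : 0 ≤ K / (1 - ρ) := div_nonneg hK0 (by linarith)
  set R₀ := exp (11 * p * (1 / 128)) with hR₀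
  have hR₀1 : 1 ≤ R₀ :=
    le_trans (by linarith [show 0 ≤ 11 * p * (1 / 128) by positivity])
      (add_one_le_exp (11 * p * (1 / 128)))
  set L₀ := R₀ * (2 / ν + 2 * ν) with hL₀
  have h2ν : 2 ≤ 2 / ν := by rw [le_div_iff₀ hνpos]; linarith
  have hL₀1 : 1 ≤ L₀ :=
    calc (1 : ℝ) ≤ 1 * 2 := by norm_num
      _ ≤ R₀ * (2 / ν + 2 * ν) := mul_le_mul hR₀1 (by linarith) (by norm_num) (by linarith)
  set C₁ := L₀ * exp (K / (1 - ρ)) with hC₁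
  have hE1 : 1 ≤ exp (K / (1 - ρ)) := le_trans (by linarith) (add_one_le_exp (K / (1 - ρ)))
  have hC₁1 : 1 ≤ C₁ := one_le_mul_of_one_le_of_one_le hL₀1 hE1
  have hC₁0 : 0 < C₁ := by linarith
  refine ⟨ν / C₁, ν * C₁, by positivity, ?_, ?_⟩
  · exact (div_le_self hνpos.le hC₁1).trans (le_mul_of_one_le_right hνpos.le hC₁1)
  intro ε εpos hε0 hratio7 hsuper hsmall M κ hκ1 hκ2 m hm1 hmM
  -- elementary consequences of `ε₀ = 1` and the minimal scale separation `2⁷`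
  have hsucc_le : ∀ n, ε (n + 1) ≤ ε n := fun n => by
    have := hratio7 n; have := εpos (n + 1); nlinarith
  have hle_one : ∀ n, ε n ≤ 1 := by
    intro n
    induction n with
    | zero => exact hε0.le
    | succ n ih => exact (hsucc_le n).trans ih
  have hsucc_le_mul : ∀ n, ε (n + 1) ≤ ((2 : ℝ) ^ 7)⁻¹ * ε n := fun n => by
    have h1 := hratio7 n
    rw [inv_mul_eq_div, le_div_iff₀ (by positivity)]
    linarith
  obtain ⟨N, rfl⟩ : ∃ N, M = N + 1 := ⟨M - 1, by omega⟩
  have hN1 : 1 ≤ N := by omega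
  have hmN : m ≤ N := by omega
  rw [h2b] at hκ1 hκ2
  have hWpos : 0 < ε (N + 1) ^ p := rpow_pos_of_pos (εpos _) _
  have hκpos : 0 < κ := lt_of_lt_of_le (by positivity) hκ1
  -- the sequences
  set a : ℕ → ℝ := fun n => ε n ^ (β - 2) with ha
  obtain ⟨k, hk⟩ : ∃ k : ℕ → ℝ, ∀ n, k n = modelDiffusivity a ε (N + 1) κ n := ⟨_, fun _ => rfl⟩
  have kpos : ∀ n, 0 < k n := fun n => by rw [hk]; exact modelDiffusivity_pos hκpos n
  obtain ⟨s, hs⟩ : ∃ s : ℕ → ℝ, ∀ n, s n = k n / (ν * ε n ^ (β + γ)) := ⟨_, fun _ => rfl⟩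
  have spos : ∀ n, 0 < s n := fun n => by
    rw [hs]; exact div_pos (kpos n) (mul_pos hνpos (rpow_pos_of_pos (εpos n) _))
  -- `εₙ^{β+γ} = εₙ^{β-γ} εₙ^{2γ}`
  have hsplit : ∀ n, ε n ^ (β + γ) = ε n ^ p * ε n ^ (2 * γ) := fun n => by
    rw [← rpow_add (εpos n)]; congr 1; rw [hp]; ring
  -- `κ'ₙ = ν sₙ εₙ^{β-γ} εₙ^{2γ}`
  have hkS : ∀ n, k n = ν * s n * (ε n ^ p * ε n ^ (2 * γ)) := fun n => by
    rw [hs, ← hsplit]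
    have := (rpow_pos_of_pos (εpos n) (β + γ)).ne'
    field_simp
  -- (3.51): the recursion in the rescaled variable
  have hrec : ∀ n, n + 1 ≤ N + 1 →
      s n = (ε (n + 1) ^ p / ε n ^ (β + γ)) *
        (s (n + 1) * ε (n + 1) ^ (2 * γ) + (s (n + 1))⁻¹) := by
    intro n hn
    have hkn : k n = ν * ε (n + 1) ^ p * (s (n + 1) * ε (n + 1) ^ (2 * γ) + (s (n + 1))⁻¹) := by
      rw [hk, modelDiffusivity_succ hn, ← hk, hkS (n + 1)]
      exact enhanceStep_rescale (εpos _) hνpos hν2 (spos _)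
    rw [hs n, hkn]
    have := (rpow_pos_of_pos (εpos n) (β + γ)).ne'
    have := hνpos.ne'
    field_simp
  -- the ratio factor `rₙ₊₁ = (εₙ₊₁/εₙ^q)^{β-γ}` and its bound, for `n ≥ 1`
  have hratio : ∀ n, 1 ≤ n →
      ε (n + 1) ^ p / ε n ^ (β + γ) = (ε (n + 1) / ε n ^ q) ^ p ∧
      0 < (ε (n + 1) / ε n ^ q) ^ p ∧
      max ((ε (n + 1) / ε n ^ q) ^ p) ((ε (n + 1) / ε n ^ q) ^ p)⁻¹ ≤
        exp (11 * p * (Κ * ε n / 10)) := by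
    intro n hn1
    have hyq : 0 < ε n ^ q := rpow_pos_of_pos (εpos n) q
    have hsg := hsuper n hn1
    have ht0 : 0 ≤ Κ * ε n / 10 := by have := (εpos n).le; positivity
    have ht1 : Κ * ε n / 10 ≤ 1 / 128 := by have := hsmall n hn1; linarith
    refine ⟨?_, rpow_pos_of_pos (div_pos (εpos _) hyq) _, ?_⟩
    · rw [div_rpow (εpos _).le hyq.le, ← hqp, rpow_mul (εpos n).le]
    · refine max_rpow_inv_le_exp hppos.le ht0 ht1 ?_ ?_
      · rw [le_div_iff₀ hyq, show 1 - 10 * (Κ * ε n / 10) = 1 - Κ * ε n by ring]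
        exact hsg.1
      · rw [div_le_iff₀ hyq, show 1 + 10 * (Κ * ε n / 10) = 1 + Κ * ε n by ring]
        exact hsg.2
  -- nonnegativity of `Lₙ = max{sₙ, 1/sₙ}`
  have hLnn : ∀ n, 0 ≤ max (s n) (s n)⁻¹ := fun n => (spos n).le.trans (le_max_left _ _)
  -- the one-step bound: `Lₙ ≤ exp(K εₙ^θ) Lₙ₊₁` for `1 ≤ n`, `n + 1 ≤ N + 1`
  have hone : ∀ n, 1 ≤ n → n + 1 ≤ N + 1 →
      max (s n) (s n)⁻¹ ≤ exp (K * ε n ^ θ) * max (s (n + 1)) (s (n + 1))⁻¹ := by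
    intro n hn1 hn
    obtain ⟨hr_eq, hr_pos, hr_bd⟩ := hratio n hn1
    have hx := εpos (n + 1)
    have hy := εpos n
    have hE2pos : 0 ≤ ε (n + 1) ^ (2 * γ) := (rpow_pos_of_pos hx _).le
    have hA := max_step_le (spos (n + 1)) hE2pos hr_pos
    have hsn : s n = (ε (n + 1) / ε n ^ q) ^ p *
        (s (n + 1) * ε (n + 1) ^ (2 * γ) + (s (n + 1))⁻¹) := by rw [hrec n hn, hr_eq]
    have hE2le : ε (n + 1) ^ (2 * γ) ≤ ε n ^ θ :=
      calc ε (n + 1) ^ (2 * γ) ≤ ε n ^ (2 * γ) := rpow_le_rpow hx.le (hsucc_le n) (by linarith)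
        _ ≤ ε n ^ θ := rpow_le_rpow_of_exponent_ge hy (hle_one n) hθ2
    have hεθ : ε n ≤ ε n ^ θ := by
      conv_lhs => rw [← rpow_one (ε n)]
      exact rpow_le_rpow_of_exponent_ge hy (hle_one n) hθ1
    have h11 : 11 * p * (Κ * ε n / 10) ≤ 11 * p * Κ / 10 * ε n ^ θ := by
      have : 11 * p * (Κ * ε n / 10) = 11 * p * Κ / 10 * ε n := by ring
      rw [this]
      exact mul_le_mul_of_nonneg_left hεθ (by positivity)
    have hexp1 : 1 + ε (n + 1) ^ (2 * γ) ≤ exp (ε n ^ θ) := by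
      rw [add_comm]
      exact (add_one_le_exp _).trans (exp_le_exp.mpr hE2le)
    have hprod0 : 0 ≤ (1 + ε (n + 1) ^ (2 * γ)) * max (s (n + 1)) (s (n + 1))⁻¹ :=
      mul_nonneg (by positivity) (hLnn _)
    calc max (s n) (s n)⁻¹
        ≤ max ((ε (n + 1) / ε n ^ q) ^ p) ((ε (n + 1) / ε n ^ q) ^ p)⁻¹ *
            ((1 + ε (n + 1) ^ (2 * γ)) * max (s (n + 1)) (s (n + 1))⁻¹) := by rw [hsn]; exact hA
      _ ≤ exp (11 * p * Κ / 10 * ε n ^ θ) * (exp (ε n ^ θ) * max (s (n + 1)) (s (n + 1))⁻¹) :=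
          mul_le_mul (hr_bd.trans (exp_le_exp.mpr h11))
            (mul_le_mul_of_nonneg_right hexp1 (hLnn _)) hprod0 (exp_pos _).le
      _ = exp (K * ε n ^ θ) * max (s (n + 1)) (s (n + 1))⁻¹ := by
          rw [← mul_assoc, ← exp_add]; congr 2; rw [hK]; ring
  -- the base of the cascade: `L_{M-1} ≤ L₀`
  have hbase : max (s N) (s N)⁻¹ ≤ L₀ := by
    obtain ⟨hr_eq, hr_pos, hr_bd⟩ := hratio N hN1
    have hrR : max ((ε (N + 1) / ε N ^ q) ^ p) ((ε (N + 1) / ε N ^ q) ^ p)⁻¹ ≤ R₀ :=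
      hr_bd.trans (exp_le_exp.mpr
        (mul_le_mul_of_nonneg_left (by have := hsmall N hN1; linarith) (by positivity)))
    have hEpos : 0 < ε (N + 1) ^ (2 * γ) := rpow_pos_of_pos (εpos _) _
    have hE1 : ε (N + 1) ^ (2 * γ) ≤ 1 := rpow_le_one (εpos _).le (hle_one _) (by linarith)
    have hsM : s (N + 1) = κ / (ν * (ε (N + 1) ^ p * ε (N + 1) ^ (2 * γ))) := by
      rw [hs, hk, modelDiffusivity_top, hsplit]
    rw [hrec N le_rfl, hr_eq, hL₀]
    exact base_window hνpos hWpos hEpos hE1 hκ1 hκ2 hsM hr_pos ((le_max_left _ _).trans hrR)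
      ((le_max_right _ _).trans hrR)
  -- the cascade (3.54)
  have hdec : ∀ n, ε (n + 1) ^ θ ≤ ρ * ε n ^ θ := fun n => by
    rw [hρ, ← mul_rpow (by positivity) (εpos n).le]
    exact rpow_le_rpow (εpos _).le (hsucc_le_mul n) hθpos.le
  have hcas := cascade_bound (L := fun n => max (s n) (s n)⁻¹) (e := fun n => ε n ^ θ)
    (N := N) hK0 hρ1 hLnn (fun n => (rpow_pos_of_pos (εpos n) _).le) hdec
    (fun n h1 h2 => hone n h1 (by omega)) m hm1 hmN
  have heθ1 : ε m ^ θ ≤ 1 := rpow_le_one (εpos m).le (hle_one m) hθpos.le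
  have hLm : max (s m) (s m)⁻¹ ≤ C₁ := by
    refine hcas.trans ?_
    rw [hC₁]
    exact mul_le_mul hbase (exp_le_exp.mpr (mul_le_of_le_one_right hK'0 heθ1)) (exp_pos _).le
      (zero_le_one.trans hL₀1)
  have hs_le : s m ≤ C₁ := (le_max_left _ _).trans hLm
  have hsi_le : (s m)⁻¹ ≤ C₁ := (le_max_right _ _).trans hLm
  have hs_ge : C₁⁻¹ ≤ s m := (inv_le_comm₀ (spos m) hC₁0).1 hsi_le
  -- back to `κ'ₘ = ν sₘ εₘ^{β+γ}` and `aₘ εₘ^{2+γ} = εₘ^{β+γ}`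
  have hPpos : 0 < ε m ^ (β + γ) := rpow_pos_of_pos (εpos m) _
  have hkm : k m = ν * s m * ε m ^ (β + γ) := by rw [hkS m, hsplit m]
  rw [amp_mul_rpow_eq (εpos m), ← hk m, hkm]
  constructor
  · calc ν / C₁ * ε m ^ (β + γ) = ν * C₁⁻¹ * ε m ^ (β + γ) := by rw [div_eq_mul_inv]
      _ ≤ ν * s m * ε m ^ (β + γ) :=
          mul_le_mul_of_nonneg_right (mul_le_mul_of_nonneg_left hs_ge hνpos.le) hPpos.le
  · exact mul_le_mul_of_nonneg_right (mul_le_mul_of_nonneg_left hs_le hνpos.le) hPpos.le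


/-! ### The printed scales satisfy (2.10) with the constant `max(10, 4q)` -/

section Scales

variable {Λ : ℕ} {q : ℝ} {m : ℕ}

/-- **(2.10) for the printed scales with a `q`-dependent constant**: for every `q > 1`,
`Λ ≥ 2q + 2` and `m ≥ 1`, `(1 - Κ εₘ) εₘ^q ≤ εₘ₊₁ ≤ (1 + Κ εₘ) εₘ^q` with `Κ = max(10, 4q)`
(lower half from `scaleSeq_succ_ge`, upper half from `scaleSeq_succ_le_general`; the printed
constant `10` needs `q < 10`, see `scaleSeq_succ_le`). [cite: ArmstrongVicol2025, §2.1 (2.10) p. 19] -/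
theorem scaleSeq_superGeometric_max (hq1 : 1 < q) (hΛq : 2 * q + 2 ≤ (Λ : ℝ)) (hm : 1 ≤ m) :
    (1 - max 10 (4 * q) * scaleSeq Λ q m) * scaleSeq Λ q m ^ q ≤ scaleSeq Λ q (m + 1) ∧
      scaleSeq Λ q (m + 1) ≤ (1 + max 10 (4 * q) * scaleSeq Λ q m) * scaleSeq Λ q m ^ q := by
  have hΛ1 : 1 ≤ Λ := by
    have : (1 : ℝ) ≤ Λ := by linarith
    exact_mod_cast this
  have hΛ0 : 0 < Λ := by omega
  have hε0 : 0 ≤ scaleSeq Λ q m := (scaleSeq_pos hΛ0 m).le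
  have hεq0 : 0 ≤ scaleSeq Λ q m ^ q := rpow_nonneg hε0 q
  have hK10 : (10 : ℝ) ≤ max 10 (4 * q) := le_max_left _ _
  have hK4 : 4 * q ≤ max 10 (4 * q) := le_max_right _ _
  constructor
  · calc (1 - max 10 (4 * q) * scaleSeq Λ q m) * scaleSeq Λ q m ^ q
        ≤ (1 - 10 * scaleSeq Λ q m) * scaleSeq Λ q m ^ q :=
          mul_le_mul_of_nonneg_right (by nlinarith) hεq0
      _ ≤ scaleSeq Λ q (m + 1) := scaleSeq_succ_ge hΛ1 hq1.le hm
  · calc scaleSeq Λ q (m + 1) ≤ (1 + 4 * q * scaleSeq Λ q m) * scaleSeq Λ q m ^ q :=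
          scaleSeq_succ_le_general hq1 hΛq hm
      _ ≤ (1 + max 10 (4 * q) * scaleSeq Λ q m) * scaleSeq Λ q m ^ q :=
          mul_le_mul_of_nonneg_right (by nlinarith) hεq0

/-- **Armstrong–Vicol, Lemma 3.4, Step 1 on the printed scales (2.8) for EVERY `q > 1`.** For
`β > 0` and `q > 1` there are `0 < c ≤ C` (depending on `β, q`) such that for every minimal scale
separation `Λ ∈ ℕ` with `Λ ≥ 2⁷` and `Λ ≥ 52 q`, every critical scale `M` and every diffusivity `κ`
in the window (3.44), the model cascade (3.47) over `εₘ = ⌈Λ^{q^m/(q-1)}⌉⁻¹` obeys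
`c aₘ εₘ^{2+γ} ≤ κ'ₘ ≤ C aₘ εₘ^{2+γ}` for `1 ≤ m ≤ M - 1`. Compared with
`modelDiffusivity_bounds_scaleSeq` (`q < 10`, `Λ ≥ 10(q+1)/(10-q)`) the restriction `q < 10` is
gone, at the price of the largeness `Λ ≥ 52 q` ("`Λ` … will be chosen to depend only on `β`",
p. 19; "at the cost of all constants depending additionally on `q`", p. 93).
[cite: ArmstrongVicol2025, §2.1 (2.8)–(2.10) p. 19; Lemma 3.4 p. 43, proof Step 1 (3.49) p. 44; p. 93] -/
theorem modelDiffusivity_bounds_scaleSeq_all {β q : ℝ} (hβ : 0 < β) (hq : 1 < q) :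
    ∃ c C : ℝ, 0 < c ∧ c ≤ C ∧
      ∀ Λ : ℕ, 2 ^ 7 ≤ Λ → 52 * q ≤ (Λ : ℝ) → ∀ (M : ℕ) (κ : ℝ),
        scaleSeq Λ q M ^ (2 * β / (q + 1)) / 2 ≤ κ → κ ≤ 2 * scaleSeq Λ q M ^ (2 * β / (q + 1)) →
        ∀ m : ℕ, 1 ≤ m → m < M →
          c * (scaleSeq Λ q m ^ (β - 2) * scaleSeq Λ q m ^ (2 + gammaExp β q)) ≤
              modelDiffusivity (fun n => scaleSeq Λ q n ^ (β - 2)) (scaleSeq Λ q) M κ m ∧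
            modelDiffusivity (fun n => scaleSeq Λ q n ^ (β - 2)) (scaleSeq Λ q) M κ m ≤
              C * (scaleSeq Λ q m ^ (β - 2) * scaleSeq Λ q m ^ (2 + gammaExp β q)) := by
  have hΚ0 : (0 : ℝ) ≤ max 10 (4 * q) := le_trans (by norm_num) (le_max_left _ _)
  obtain ⟨c, C, hc, hcC, h⟩ := modelDiffusivity_bounds_general hβ hq hΚ0
  refine ⟨c, C, hc, hcC, fun Λ hΛ hΛq => h (scaleSeq Λ q) ?_ ?_ ?_ ?_ ?_⟩
  · exact scaleSeq_pos (by omega)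
  · exact scaleSeq_zero Λ q
  · intro n
    have hΛr : (2 : ℝ) ^ 7 ≤ Λ := by exact_mod_cast hΛ
    calc (2 : ℝ) ^ 7 * scaleSeq Λ q (n + 1) ≤ Λ * scaleSeq Λ q (n + 1) :=
          mul_le_mul_of_nonneg_right hΛr (scaleSeq_pos (by omega) _).le
      _ ≤ scaleSeq Λ q n := scaleSeq_ratio (by omega) hq n
  · intro n hn
    exact scaleSeq_superGeometric_max hq (by linarith) hn
  · intro n hn
    have hΛr : (128 : ℝ) ≤ Λ := by exact_mod_cast hΛ
    have hΛ0 : (0 : ℝ) < Λ := by linarith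
    have hΚΛ : max 10 (4 * q) ≤ 10 / 128 * Λ := max_le (by linarith) (by linarith)
    have hε : scaleSeq Λ q n ≤ 1 / (Λ : ℝ) := scaleSeq_le_inv (by omega) hq hn
    calc max 10 (4 * q) * scaleSeq Λ q n ≤ (10 / 128 * Λ) * (1 / Λ) :=
          mul_le_mul hΚΛ hε (scaleSeq_pos (by omega) _).le (by positivity)
      _ = 10 / 128 := by field_simp

/-- **Lemma 3.4, Step 1 on the printed scales with the printed exponent `q = qExp β`, for EVERY
`β ∈ (1, 4/3)`** (the companion `modelDiffusivity_bounds_scaleSeq` / `isScaleSequence_scaleSeq_qExp`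
needed `β > 40/39`, i.e. `qExp β < 10`): for all `Λ ≥ 2⁷` with `Λ ≥ 52 qExp β`.
[cite: ArmstrongVicol2025, §2.1 (2.2), (2.8)–(2.10) pp. 18–19; Lemma 3.4 p. 43, proof Step 1 (3.49) p. 44] -/
theorem modelDiffusivity_bounds_scaleSeq_qExp_all {β : ℝ} (h1 : 1 < β) (h2 : β < 4 / 3) :
    ∃ c C : ℝ, 0 < c ∧ c ≤ C ∧
      ∀ Λ : ℕ, 2 ^ 7 ≤ Λ → 52 * qExp β ≤ (Λ : ℝ) → ∀ (M : ℕ) (κ : ℝ),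
        scaleSeq Λ (qExp β) M ^ (2 * β / (qExp β + 1)) / 2 ≤ κ →
        κ ≤ 2 * scaleSeq Λ (qExp β) M ^ (2 * β / (qExp β + 1)) →
        ∀ m : ℕ, 1 ≤ m → m < M →
          c * (scaleSeq Λ (qExp β) m ^ (β - 2) * scaleSeq Λ (qExp β) m ^ (2 + gammaExp β (qExp β))) ≤
              modelDiffusivity (fun n => scaleSeq Λ (qExp β) n ^ (β - 2)) (scaleSeq Λ (qExp β)) M κ m ∧
            modelDiffusivity (fun n => scaleSeq Λ (qExp β) n ^ (β - 2)) (scaleSeq Λ (qExp β)) M κ m ≤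
              C * (scaleSeq Λ (qExp β) m ^ (β - 2) *
                scaleSeq Λ (qExp β) m ^ (2 + gammaExp β (qExp β))) :=
  modelDiffusivity_bounds_scaleSeq_all (by linarith) (one_lt_qExp h1 h2)

end Scales

end ArmstrongVicol2025

end Literature.Analysis.FluidPDE
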